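import Literature.NumberTheory.Automorphic.Liu2021.LemD1AsPrintedIndexedNonVacuity
import Literature.NumberTheory.Automorphic.Liu2021.LemD1FamilyOfPlace
import Literature.NumberTheory.GelbartRogawski1991.LocalUnitarySplitPlaceLagrangian
import Mathlib.RingTheory.RootsOfUnity.Complex
import HarnessLib

/-!
# [Liu2021, App. D Lemma D.1 (1) ∧ (3)] as printed on an indexed collection — NON-VACUITY AT THE PLACE MODEL
# of a quadratic extension of number fields (the slot types of the tree's local data), at a split place

Reproduction ∕ bookkeeping (Literature, THEOREMS ONLY: no definition, no record, no named fact, no `sorry`; nothing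
is asserted about Liu's oscillator representations or about the tree's constructed local Weil carriers).

The certificates of `LemD1AsPrintedIndexedNonVacuity.lean` (split étale algebra `K_v × K_v`),
`…NonVacuityNonsplit.lean` (`ℚ₃(i)/ℚ₃`), `…NonVacuityRamified.lean` (`ℚ₃(√3)/ℚ₃`) exercise the statement-exact records
`LemD1IndexedFamily.Item1AsPrinted` ([Liu2021, App. D, Lemma D.1, first sentence + (1)], `FJcycle.tex` l. 5227–5229,
member by member) and `LemD1_3AsPrintedI` (Lemma D.1 (3), l. 5233, read on an indexed collection) on standing data BUILT FOR
THE PURPOSE.  The tree's consumers read the same two records on data whose slots are the tree's PLACE MODEL of a quadratic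
extension `E/F` of number fields at a finite place `v` of `F` (`Liu2021/LemD1DataOfPlace.lean`, `LemD1FamilyOfPlace.lean`,
`Def411WeilCarriersLocalDataAtV.lean`):

* `F := F_v = v.adicCompletion F` (a non-archimedean local field, tree `AdicCompletionLocalField`),
* `E := E_v = E ⊗_F F_v = Π_{w ∣ v} E_w` (`UnitaryGroup.LocalRing E v`) with `c ⊗ 1` (`UnitaryGroup.conjLocal`),
* `S := LemD1OfPlace.standingData E v c N J hcδ hδ hN hJh hJdet` — the hermitian space `(E_vᴺ, J ⊗ 1)`, `U(V)(F_v) = S.U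
  ≃ₜ* UnitaryGroup.localPi E c N J v` (`LemD1OfPlace.uEquiv`),
* Step 1's representative a unit of `E_v` in `E_v⁻` (e.g. `LemD1OfPlace.eps` = `δ ⊗ 1`, `Def411WeilCarriers.epsLine` =
  `(a·δ) ⊗ 1`), Step 2's `μ_v` packaged by `LemD1OfPlace.muOf`, Step 3's `χ_v ∘ θ` packaged by `LemD1OfPlace.chiOf`.

THIS FILE certifies IN THE KERNEL that AT THESE VERY SLOT TYPES — same `F_v`, same `E_v`, same `S` (any hermitian `J`
with `det J ≠ 0`, any `N ≥ 2`), ANY Step-1 representative `e` — the pair «(1) for every member ∧ (3)» is JOINTLY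
SATISFIABLE and NON-TRIVIALLY so in `μ`, whenever `v` SPLITS in `E` (a place `w ∣ v` with `c • w ≠ w`; the case of
[Liu2021]'s proof l. 5241 «We identify `U(V)` with `GL_n(F)` … through the first factor», in the tree
`UnitaryGroup.localPiSplitEquiv : U(J)(F_v) ≃ₜ* GL_N(E_w)`):

* §1 (the split place model, folklore) `E_v` is NOT a field (`not_isField_localRing_of_split`: the idempotent `e_w` of
  the factor `E_w` is a zero-divisor, `e_w · (c ⊗ 1)(e_w) = 0`); EVERY `a ∈ F_vˣ` is a norm `x · (c ⊗ 1) x`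
  (`exists_mul_conjLocal_eq_algebraMap_of_split`, `x = ι_v(a) e_w + (1 − e_w)`), so the printed Step-2 clause «`μ|_{F^×}`
  has kernel exactly `Nm E^×`» reads «`μ|_{F_vˣ} = 1`» and the trivial character is a Step-2 character
  (`one_mem_muSet_of_split`);
* §2 the unramified character `ν_w = ζ_N^{ord_w}` of `E_wˣ` of order dividing `N` (unitary, locally constant, non-trivial at
  a uniformiser);
* §3 a SECOND Step-2 character `μ₁ := λ · (λ ∘ (c ⊗ 1))⁻¹`, `λ = ν_w ∘ pr_w` (`exists_muSet_ne_one_of_split`: in `MuSet S`,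
  and `≠ 1` at the unit `(ϖ_w at w, 1 at w̄)`);
* §4 the carrier character `Λ := ν_w ∘ det ∘ pr_w : U(J)(F_v) → ℂˣ` (trivial on the centre `E_v¹` since `ν_w^N = 1`, trivial
  on the open set `{ord_w det g_w = 0}`, and `≠ 1` at the element of `U(J)(F_v)` with `w`-component `diag(ϖ_w, 1, …, 1)`
  supplied by `localPiSplitEquiv`);
* §5 **`lemD1_1AsPrinted_data_one_of_split`, `lemD1_1AsPrinted_data_character_of_split`** — in the CURRENCY OF THE DISPLAYED
  ROW `hD1''` (`LemD1_1AsPrinted (LemD1OfPlace.data E v c N J hcδ hδ hN hJh hJdet J₁ ω μ hμn hμc hμF χ hχn hχc)`): for EVERY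
  Step-2 datum `μ, hμn, hμc, hμF`, every `J₁`, the centre character `χ = 1`, and the carrier `ω` = the trivial line, resp.
  the line `Λ`, the record [Lem. D.1, first sentence + (1)] AS PRINTED HOLDS at the junction datum `LemD1OfPlace.data` (both
  sides of (1) false: the line is non-zero; `E_v` is not a field);
* §6 **`exists_lemD1IndexedFamily_of_split`** — a two-member `Lf : LemD1IndexedFamily F_v E_v N (Fin 2)` with
  `Lf.S = LemD1OfPlace.standingData …` (the rows' `S` VERBATIM), `Lf.eps i = e` (any given representative), `Lf.chi i = 1`,
  `Lf.mu 0 = 1 ≠ Lf.mu 1 = μ₁`, carriers the two lines of §5, such that `Lf.Item1AsPrinted ∧ LemD1_3AsPrintedI Lf` and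
  `ω(μ₁, ε, χ) ≇ ω(1, ε, χ)`; corollary `not_forall_mu_eq_of_split` (the two displayed records do not, by their shape at the
  rows' slot types, force «all members carry the same `μ`», let alone `False`).

What this does NOT say: nothing about non-split `v` beyond §7–§8 (there the Step-2 clause is a genuine index-2 condition
and a full model of «(1) ∧ (3)» needs local class field theory for `E_w/F_v` and a ramified carrier character); nothing
about the rows' OWN carriers (`𝓢.omegaLoc v`, Schwartz–Bruhat spaces) or their `χ_v` (`localCharOfCenter`); nothing about
the truth of Lemma D.1.  HC_CM is NOT proved.

v2 (APPEND-only, §§1–6 byte-identical): §7 — over ANY standing data of §D.1, every Step-2 character has `μ(a)² = 1` on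
`F^×` (`a² = a·a^c` is a norm), so odd powers and inverses of Step-2 characters are Step-2 characters and ONE non-quadratic
`μ` gives two elements `μ ≠ μ³` of `MuSet S` (`exists_muSet_ne_of_sq_ne_one`); §8 — at EVERY finite place (split or not),
rank `N ≠ 2`: the `hD1''` type former `LemD1_1AsPrinted (LemD1OfPlace.data … J₁ (trivial line) μ hμn hμc hμF 1 h1n h1c)` HOLDS
for every Step-2 datum `μ` (`lemD1_1AsPrinted_data_trivial_of_rank_ne_two`), the rows' packaging `muOf` separates `μ` from
`μ³` (`exists_muOf_ne_of_sq_ne_one`), and the record (3) has teeth at the place model: the two-member collection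
`(μ, e, 1), (μ³, e, 1)` on the trivial line satisfies (1) member by member but VIOLATES `LemD1_3AsPrintedI`
(`exists_lemD1IndexedFamily_item1_not_lemD1_3_of_sq_ne_one`).

v3 (APPEND-only, §§1–8 byte-identical): §9 — at EVERY split place a NON-QUADRATIC Step-2 character exists
(`exists_mu_sq_ne_one_of_split`: the construction of §3 with the unramified character of order `3`), so the hypothesis
`∃ x, μ(x)² ≠ 1` of §8 is discharged there and [Lem. D.1 (3)] AS PRINTED is VIOLATED at every split place by a two-`μ`-label
trivial-carrier collection satisfying (1) (`exists_lemD1IndexedFamily_item1_not_lemD1_3_of_split`,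
`not_forall_lemD1_3_of_item1_of_split`) — with §6, (3) is independent of «(1) for every member» at the rows' slot types there.

Cell pub-hodgecm2 (COR-CM), audit class of the END rows `hD1''` ∕ `hD3`; seat prover-pub-hodgecm2-b10 (the lineage that
filed `LemD1AsPrintedIndexed.lean`, `LemD1DataOfPlace.lean`'s family twin and the three earlier certificates).

References: [Liu2021] Y. Liu, *Fourier–Jacobi cycles and arithmetic relative trace formula*, Camb. J. Math. 9 (2021) =
arXiv:2102.11518, App. D §D.1 Steps 1–3 (`FJcycle.tex` l. 5213–5224), Lemma D.1 (1) (l. 5229), (3) (l. 5233), split case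
of the proof l. 5241; [CasselsFrohlichANT1967] Ch. II §10 (`L ⊗_K K_v = Π_{w∣v} L_w`); [Mok2014] §1 Notation p. 5
(`U(N)(F_v) ≅ GL_N(E_w)` at a split `v`).
-/

noncomputable section

open scoped Matrix MatrixGroups
open NumberField IsDedekindDomain
open Literature.RepresentationTheory
open Literature.RepresentationTheory.Liu2021 (OscillatorStandingData)
open Literature.RepresentationTheory.CentralCharacterQuotient (augmentation quotRep quotRep_mk)
open Literature.NumberTheory.GelbartRogawski1991.UnitaryDualPair.LocalSplitting (splitIdem)

namespace Literature.NumberTheory.Automorphic.Liu2021.LemD1IndexedNonVacuityAtPlace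

open UnitaryGroup

variable {F : Type} (E : Type) [Field F] [NumberField F] [Field E] [NumberField E] [Algebra F E]
  [Algebra.IsQuadraticExtension F E] (v : HeightOneSpectrum (𝓞 F)) (c : E ≃ₐ[F] E)

/-! ## §1 The place model `E_v = Π_{w ∣ v} E_w` at a split place: not a field; every `a ∈ F_v` is a norm -/

omit [NumberField F] [NumberField E] [Algebra.IsQuadraticExtension F E] in
/-- at a split place `c ≠ 1`. [folklore] -/
private theorem hc_of_hw {w : PlacesOver E v} (hw : c • w.1 ≠ w.1) : c ≠ 1 := by
  rintro rfl; exact hw (one_smul _ _)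

omit [NumberField F] [Algebra.IsQuadraticExtension F E] in
/-- unfolding of the tree's idempotent `e_w` of the factor `E_w ⊂ Π_{w' ∣ v} E_{w'}`. [cite: CasselsFrohlichANT1967, Ch. II §10] -/
private theorem splitIdem_apply (w w' : PlacesOver E v) :
    splitIdem F E v w w' = open scoped Classical in if w' = w then 1 else 0 := rfl

omit [NumberField F] [Algebra.IsQuadraticExtension F E] in
/-- `e_w² = e_w`. [cite: CasselsFrohlichANT1967, Ch. II §10] -/
private theorem splitIdem_mul_self (w : PlacesOver E v) : splitIdem F E v w * splitIdem F E v w = splitIdem F E v w := by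
  funext w'
  rw [Pi.mul_apply, splitIdem_apply]
  by_cases h : w' = w
  · rw [if_pos h, mul_one]
  · rw [if_neg h, mul_zero]

/-- `e_w + (c ⊗ 1)(e_w) = 1` at a split place (the two places above `v` are `w` and `c⁻¹ w ≠ w`).
[cite: CasselsFrohlichANT1967, Ch. II §10] -/
private theorem splitIdem_add_conjLocal (w : PlacesOver E v) (hw : c • w.1 ≠ w.1) :
    splitIdem F E v w + conjLocal E c v (splitIdem F E v w) = 1 := by
  have hc : c ≠ 1 := hc_of_hw E v c hw
  funext w'
  simp only [Pi.add_apply, Pi.one_apply, conjLocal_apply]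
  rcases PlacesOver.eq_or_eq_galInv c hc w w' with rfl | rfl
  · rw [splitIdem_apply, if_pos rfl, splitIdem_apply, if_neg (PlacesOver.galInv_ne c w' hw), map_zero, add_zero]
  · rw [splitIdem_apply, if_neg (PlacesOver.galInv_ne c w hw), splitIdem_apply,
      if_pos (PlacesOver.galInv_galInv c hc w), map_one, zero_add]

/-- `(c ⊗ 1)(e_w) = 1 − e_w` at a split place. [cite: CasselsFrohlichANT1967, Ch. II §10] -/
private theorem conjLocal_splitIdem (w : PlacesOver E v) (hw : c • w.1 ≠ w.1) :
    conjLocal E c v (splitIdem F E v w) = 1 - splitIdem F E v w := by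
  rw [eq_sub_iff_add_eq, add_comm]
  exact splitIdem_add_conjLocal E v c w hw

/-- `e_w · (c ⊗ 1)(e_w) = 0` at a split place. [cite: CasselsFrohlichANT1967, Ch. II §10] -/
private theorem splitIdem_mul_conjLocal (w : PlacesOver E v) (hw : c • w.1 ≠ w.1) :
    splitIdem F E v w * conjLocal E c v (splitIdem F E v w) = 0 := by
  rw [conjLocal_splitIdem E v c w hw, mul_sub, mul_one, splitIdem_mul_self, sub_self]

omit [NumberField F] [Algebra.IsQuadraticExtension F E] in
/-- `e_w ≠ 0`. [cite: CasselsFrohlichANT1967, Ch. II §10] -/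
private theorem splitIdem_ne_zero (w : PlacesOver E v) : splitIdem F E v w ≠ 0 := fun h => by
  have := congrFun h w
  rw [splitIdem_apply, if_pos rfl, Pi.zero_apply] at this
  exact one_ne_zero this

/-- **`E_v = E ⊗_F F_v` is NOT a field at a split place** (it is `E_w × E_w̄`: the idempotent `e_w` and its conjugate are
non-zero with product `0`).  So at a split place the right-hand side «`E` is a field ∧ …» of [Liu2021, Lem. D.1 (1)] is FALSE
for the place model. [cite: CasselsFrohlichANT1967, Ch. II §10] -/
theorem not_isField_localRing_of_split (w : PlacesOver E v) (hw : c • w.1 ≠ w.1) : ¬ IsField (LocalRing E v) := by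
  intro hF
  letI := hF.toField
  have h1 : splitIdem F E v w ≠ 0 := splitIdem_ne_zero E v w
  have h2 : conjLocal E c v (splitIdem F E v w) ≠ 0 := fun h => h1 (by
    have := congrArg (conjLocal E c v) h
    rwa [map_zero, conjLocal_splitIdem E v c w hw, map_sub, map_one, conjLocal_splitIdem E v c w hw, sub_sub_cancel] at this)
  exact mul_ne_zero h1 h2 (splitIdem_mul_conjLocal E v c w hw)

/-- **at a split place EVERY `a ∈ F_v` is a norm from `E_v`**: `x := ι_v(a) e_w + (1 − e_w)` (i.e. `(a, 1)` in `E_w × E_w̄`)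
satisfies `x · (c ⊗ 1)(x) = ι_v(a)`. [cite: CasselsFrohlichANT1967, Ch. II §10] -/
theorem mul_conjLocal_eq_toLocalRing_of_split (w : PlacesOver E v) (hw : c • w.1 ≠ w.1) (a : v.adicCompletion F) :
    (toLocalRing E v a * splitIdem F E v w + (1 - splitIdem F E v w)) *
        conjLocal E c v (toLocalRing E v a * splitIdem F E v w + (1 - splitIdem F E v w)) = toLocalRing E v a := by
  set e := splitIdem F E v w with he
  have hee : e * e = e := splitIdem_mul_self E v w
  have hce : conjLocal E c v e = 1 - e := conjLocal_splitIdem E v c w hw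
  rw [map_add, map_mul, map_sub, map_one, conjLocal_toLocalRing, hce, sub_sub_cancel]
  have h1 : e * (1 - e) = 0 := by rw [mul_sub, mul_one, hee, sub_self]
  have h2 : (1 - e) * (1 - e) = 1 - e := by
    rw [sub_mul, one_mul, mul_sub, mul_one, hee, sub_self, sub_zero]
  calc (toLocalRing E v a * e + (1 - e)) * (toLocalRing E v a * (1 - e) + e)
        = toLocalRing E v a * toLocalRing E v a * (e * (1 - e)) + toLocalRing E v a * (e * e) +
            toLocalRing E v a * ((1 - e) * (1 - e)) + e * (1 - e) := by ring
    _ = toLocalRing E v a := by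
          rw [h1, hee, h2, mul_zero, zero_add, add_zero, ← mul_add, add_sub_cancel, mul_one]

/-- **at a split place EVERY unit `a ∈ F_vˣ` is a norm `x · (c ⊗ 1)(x)` of a unit `x ∈ E_vˣ`** — the right-hand side of the
printed Step-2 clause «`μ(a) = 1 ↔ a ∈ Nm_{E/F} E^×`» is identically TRUE at a split place. [cite: Liu2021, App. D §D.1 Step 2 (l. 5219)] -/
theorem exists_mul_conjLocal_eq_algebraMap_of_split (w : PlacesOver E v) (hw : c • w.1 ≠ w.1)
    (a : (v.adicCompletion F)ˣ) :
    ∃ x : (LocalRing E v)ˣ, (x : LocalRing E v) * conjLocal E c v x =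
      algebraMap (v.adicCompletion F) (LocalRing E v) a := by
  set x₀ : LocalRing E v := toLocalRing E v a * splitIdem F E v w + (1 - splitIdem F E v w) with hx₀
  have hx₀n := mul_conjLocal_eq_toLocalRing_of_split E v c w hw (a : v.adicCompletion F)
  have hu : IsUnit x₀ := by
    refine isUnit_of_mul_isUnit_left (y := conjLocal E c v x₀) ?_
    rw [hx₀, hx₀n]
    exact a.isUnit.map (toLocalRing E v)
  refine ⟨hu.unit, ?_⟩
  rw [IsUnit.unit_spec, hx₀, hx₀n, algebraMap_localRing_eq]

/-- **the trivial character is a Step-2 character at a split place**: `μ = 1 : E_vˣ → ℂˣ` has values in `ℂ^1`, is continuous,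
and satisfies the printed clause «`μ|_{F_vˣ}` has kernel exactly `Nm E_vˣ`» (both sides true for every `a`). [cite: Liu2021, App. D §D.1 Step 2 (l. 5219)] -/
theorem one_mem_muSet_of_split (w : PlacesOver E v) (hw : c • w.1 ≠ w.1) :
    (∀ x : (LocalRing E v)ˣ, ‖(((1 : (LocalRing E v)ˣ →* ℂˣ) x : ℂˣ) : ℂ)‖ = 1) ∧
      (Continuous fun x : (LocalRing E v)ˣ => (((1 : (LocalRing E v)ˣ →* ℂˣ) x : ℂˣ) : ℂ)) ∧
      ∀ a : (v.adicCompletion F)ˣ,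
        (1 : (LocalRing E v)ˣ →* ℂˣ) (Units.map (algebraMap (v.adicCompletion F) (LocalRing E v)).toMonoidHom a) = 1 ↔
          ∃ x : (LocalRing E v)ˣ, (x : LocalRing E v) * conjLocal E c v x =
            algebraMap (v.adicCompletion F) (LocalRing E v) a :=
  ⟨fun x => by simp, by simpa using continuous_const,
    fun a => iff_of_true (by simp) (exists_mul_conjLocal_eq_algebraMap_of_split E v c w hw a)⟩

/-! ## §2 The unramified character `ν_w = ζ_N^{ord_w}` of `E_wˣ` of order dividing `N` -/

omit [Algebra F E] [Algebra.IsQuadraticExtension F E] in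
/-- **an unramified character of `E_wˣ` of order dividing `N ≥ 2`**: for `ζ_N = e^{2πi/N}` the map `x ↦ ζ_N^{ord_w x}` is a
unitary character of `E_wˣ`, continuous (locally constant), trivial on the units `ord_w x = 0`, with `ν^N = 1`, and `≠ 1` at a
uniformiser.  Stated as an existence so that no definition is introduced. [folklore] -/
private theorem exists_unramified_character (w : HeightOneSpectrum (𝓞 E)) {N : ℕ} (hN : 2 ≤ N) :
    ∃ ν : (w.adicCompletion E)ˣ →* ℂˣ,
      (∀ x, ‖((ν x : ℂˣ) : ℂ)‖ = 1) ∧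
      (Continuous fun x : (w.adicCompletion E)ˣ => ((ν x : ℂˣ) : ℂ)) ∧
      (∀ x : (w.adicCompletion E)ˣ, Valued.v (x : w.adicCompletion E) = 1 → ν x = 1) ∧
      (∀ x, ν x ^ N = 1) ∧
      ∃ ϖ : (w.adicCompletion E)ˣ, Valued.v (ϖ : w.adicCompletion E) = WithZero.exp (-1 : ℤ) ∧ ν ϖ ≠ 1 := by
  have hN0 : N ≠ 0 := by omega
  have hprim : IsPrimitiveRoot (Complex.exp (2 * Real.pi * Complex.I / (N : ℕ))) N := Complex.isPrimitiveRoot_exp N hN0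
  set ζ : ℂˣ := (hprim.isUnit hN0).unit with hζdef
  have hζval : (ζ : ℂ) = Complex.exp (2 * Real.pi * Complex.I / (N : ℕ)) := (hprim.isUnit hN0).unit_spec
  have hζ : IsPrimitiveRoot ζ N := IsPrimitiveRoot.coe_units_iff.1 (by rw [hζval]; exact hprim)
  have hζN : ζ ^ N = 1 := hζ.pow_eq_one
  have hζne : ζ ≠ 1 := hζ.ne_one (by omega)
  have hζnorm : ‖(ζ : ℂ)‖ = 1 := by rw [hζval]; exact hprim.norm'_eq_one hN0
  set f : Multiplicative ℤ →* ℂ := (Units.coeHom ℂ).comp (zpowersHom ℂˣ ζ) with hfdef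
  set ν₀ : w.adicCompletion E →*₀ ℂ :=
    (WithZero.lift' f).comp (Valued.v : Valuation (w.adicCompletion E) (WithZero (Multiplicative ℤ))).toMonoidWithZeroHom
    with hν₀def
  have hν₀ : ∀ x : w.adicCompletion E, x ≠ 0 → ν₀ x = ((ζ ^ WithZero.log (Valued.v x) : ℂˣ) : ℂ) := by
    intro x hx
    have hvx : Valued.v x ≠ 0 := (Valuation.ne_zero_iff _).2 hx
    rw [hν₀def, MonoidWithZeroHom.comp_apply]
    change WithZero.lift' f (Valued.v x) = _
    conv_lhs => rw [← WithZero.exp_log hvx]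
    rw [show WithZero.exp (WithZero.log (Valued.v x)) =
        ((Multiplicative.ofAdd (WithZero.log (Valued.v x)) : Multiplicative ℤ) : WithZero (Multiplicative ℤ)) from rfl,
      WithZero.lift'_coe, hfdef, MonoidHom.comp_apply, zpowersHom_apply, Units.coeHom_apply]
    rfl
  set ν : (w.adicCompletion E)ˣ →* ℂˣ := Units.map ν₀.toMonoidHom with hνdef
  have hν : ∀ x : (w.adicCompletion E)ˣ, ν x = ζ ^ WithZero.log (Valued.v (x : w.adicCompletion E)) := by
    intro x
    apply Units.ext
    rw [hνdef, Units.coe_map]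
    exact hν₀ x x.ne_zero
  refine ⟨ν, fun x => ?_, ?_, fun x hx => ?_, fun x => ?_, ?_⟩
  · rw [hν, Units.val_zpow_eq_zpow_val, norm_zpow, hζnorm, one_zpow]
  · refine (IsLocallyConstant.iff_eventually_eq _).2 (fun x₀ => ?_) |>.continuous
    have hx₀ : Valued.v (x₀ : w.adicCompletion E) ≠ 0 := (Valuation.ne_zero_iff _).2 x₀.ne_zero
    have hnhds : {y : (w.adicCompletion E)ˣ | Valued.v (y : w.adicCompletion E) = Valued.v (x₀ : w.adicCompletion E)} ∈
        nhds x₀ :=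
      Units.continuous_val.continuousAt.preimage_mem_nhds (Valued.locally_const hx₀)
    refine Filter.mem_of_superset hnhds fun y hy => ?_
    simp only [Set.mem_setOf_eq] at hy ⊢
    rw [hν, hν, hy]
  · rw [hν, hx, WithZero.log_one, zpow_zero]
  · rw [hν, ← zpow_natCast, ← zpow_mul, mul_comm, zpow_mul, zpow_natCast, hζN, one_zpow]
  · obtain ⟨π, hπ⟩ := IsDedekindDomain.HeightOneSpectrum.valuation_exists_uniformizer E w
    have hπv : Valued.v (π : w.adicCompletion E) = WithZero.exp (-1 : ℤ) := by
      rw [IsDedekindDomain.HeightOneSpectrum.valuedAdicCompletion_eq_valuation', hπ]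
    have hπ0 : (π : w.adicCompletion E) ≠ 0 := by
      intro h
      rw [h, map_zero] at hπv
      exact WithZero.exp_ne_zero hπv.symm
    refine ⟨Units.mk0 _ hπ0, hπv, ?_⟩
    rw [hν, Units.val_mk0, hπv, WithZero.log_exp, zpow_neg, zpow_one, Ne, inv_eq_one]
    exact hζne

/-! ## §3 A second Step-2 character at a split place: `μ₁ = λ · (λ ∘ (c ⊗ 1))⁻¹`, `λ = ν_w ∘ pr_w` -/

omit [Algebra.IsQuadraticExtension F E] in
/-- **a NON-TRIVIAL Step-2 character of `E_vˣ` at a split place**: there is `μ : E_vˣ → ℂ^1`, continuous, trivial on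
`ι_v(F_vˣ)` (hence satisfying the printed clause, both sides of which are true at a split place), with `μ ≠ 1` — namely
`μ = λ · (λ ∘ (c ⊗ 1))⁻¹` for `λ = ν_w ∘ pr_w`, `ν_w` an unramified character of `E_wˣ` (`μ(ι_v a) = 1` because `c ⊗ 1` fixes
`ι_v a`; `μ ≠ 1` at the unit with `w`-component a uniformiser and `w̄`-component `1`). [cite: Liu2021, App. D §D.1 Step 2 (l. 5219)] -/
theorem exists_mu_ne_one_of_split (w : PlacesOver E v) (hw : c • w.1 ≠ w.1) :
    ∃ μ : (LocalRing E v)ˣ →* ℂˣ,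
      (∀ x, ‖((μ x : ℂˣ) : ℂ)‖ = 1) ∧ (Continuous fun x => ((μ x : ℂˣ) : ℂ)) ∧
      (∀ a : (v.adicCompletion F)ˣ, μ (Units.map (algebraMap (v.adicCompletion F) (LocalRing E v)).toMonoidHom a) = 1) ∧
      μ ≠ 1 := by
  classical
  obtain ⟨ν, hνnorm, hνcont, -, -, ϖ, -, hϖ⟩ := exists_unramified_character E w.1 (le_refl 2)
  -- `λ = ν ∘ pr_w` and the conjugation `κ = c ⊗ 1` on units
  let prw : (LocalRing E v)ˣ →* (w.1.adicCompletion E)ˣ :=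
    Units.map (Pi.evalRingHom (fun w' : PlacesOver E v => w'.1.adicCompletion E) w).toMonoidHom
  let κ : (LocalRing E v)ˣ →* (LocalRing E v)ˣ := Units.map (conjLocal E c v).toMonoidHom
  let lam : (LocalRing E v)ˣ →* ℂˣ := ν.comp prw
  have hlam : ∀ x, lam x = ν (prw x) := fun x => rfl
  let μ : (LocalRing E v)ˣ →* ℂˣ := lam * (lam.comp κ)⁻¹
  have hμ : ∀ x, μ x = lam x * (lam (κ x))⁻¹ := fun x => rfl
  refine ⟨μ, fun x => ?_, ?_, fun a => ?_, ?_⟩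
  · rw [hμ, Units.val_mul, Units.val_inv_eq_inv_val, norm_mul, norm_inv, hlam, hlam, hνnorm, hνnorm, inv_one, mul_one]
  · have hc1 : Continuous fun x : (LocalRing E v)ˣ => ((lam x : ℂˣ) : ℂ) :=
      hνcont.comp (Continuous.units_map _ (continuous_apply w))
    have hc2 : Continuous fun x : (LocalRing E v)ˣ => ((lam (κ x) : ℂˣ) : ℂ) :=
      hc1.comp (Continuous.units_map _ (continuous_conjLocal E c v))
    have heq : (fun x : (LocalRing E v)ˣ => ((μ x : ℂˣ) : ℂ)) =
        fun x => ((lam x : ℂˣ) : ℂ) * (((lam (κ x) : ℂˣ) : ℂ))⁻¹ := by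
      funext x; rw [hμ, Units.val_mul, Units.val_inv_eq_inv_val]
    rw [heq]
    exact hc1.mul (hc2.inv₀ fun x => Units.ne_zero _)
  · -- `c ⊗ 1` fixes `ι_v a`, so `κ (ι_v a) = ι_v a` and `μ (ι_v a) = λ(ι_v a) λ(ι_v a)⁻¹ = 1`
    have hκ : κ (Units.map (algebraMap (v.adicCompletion F) (LocalRing E v)).toMonoidHom a) =
        Units.map (algebraMap (v.adicCompletion F) (LocalRing E v)).toMonoidHom a := by
      apply Units.ext
      change conjLocal E c v (algebraMap (v.adicCompletion F) (LocalRing E v) (a : v.adicCompletion F)) = _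
      rw [algebraMap_localRing_eq, conjLocal_toLocalRing]
      rfl
    rw [hμ, hκ, mul_inv_cancel]
  · -- the unit `z = (ϖ at w, 1 at w̄)`: `λ z = ν ϖ ≠ 1`, `λ (κ z) = ν 1 = 1`
    intro hμ1
    let z : (LocalRing E v)ˣ := MulEquiv.piUnits.symm (Pi.mulSingle w ϖ)
    have hz : ∀ w' : PlacesOver E v, (z : LocalRing E v) w' =
        (((Pi.mulSingle w ϖ : ∀ w'' : PlacesOver E v, (w''.1.adicCompletion E)ˣ) w' : (w'.1.adicCompletion E)ˣ) :
          w'.1.adicCompletion E) :=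
      fun w' => rfl
    have h1 : prw z = ϖ := by
      apply Units.ext
      change (z : LocalRing E v) w = _
      rw [hz, Pi.mulSingle_eq_same]
    have h2 : prw (κ z) = 1 := by
      apply Units.ext
      change conjLocal E c v (z : LocalRing E v) w = 1
      rw [conjLocal_apply, hz ⟨c⁻¹ • w.1, under_inv_smul_eq c w⟩,
        Pi.mulSingle_eq_of_ne (PlacesOver.galInv_ne c w hw), Units.val_one, map_one]
    have : μ z = (1 : (LocalRing E v)ˣ →* ℂˣ) z := by rw [hμ1]
    rw [hμ, MonoidHom.one_apply, hlam, hlam, h1, h2, map_one, inv_one, mul_one] at this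
    exact hϖ this

variable (N : ℕ) (J : Matrix (Fin N) (Fin N) E) {δ : E} (hcδ : c δ = -δ) (hδ : δ ≠ 0) (hN : 2 ≤ N)
  (hJh : (J.map c)ᵀ = J) (hJdet : J.det ≠ 0)

/-- **at a split place the index set `MuSet S` of the standing data AT THE PLACE MODEL has two distinct elements**: the trivial
character and `μ₁` of `exists_mu_ne_one_of_split`, both packaged by the tree's `LemD1OfPlace.muOf` (the packaging of the displayed
rows). [cite: Liu2021, App. D §D.1 Step 2 (l. 5219)] -/
theorem exists_muOf_ne_muOf_one_of_split (w : PlacesOver E v) (hw : c • w.1 ≠ w.1) :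
    ∃ (μ : (LocalRing E v)ˣ →* ℂˣ) (hμn : ∀ x, ‖((μ x : ℂˣ) : ℂ)‖ = 1) (hμc : Continuous fun x => ((μ x : ℂˣ) : ℂ))
      (hμF : ∀ a : (v.adicCompletion F)ˣ,
        μ (Units.map (algebraMap (v.adicCompletion F) (LocalRing E v)).toMonoidHom a) = 1 ↔
          ∃ x : (LocalRing E v)ˣ, (x : LocalRing E v) * conjLocal E c v x =
            algebraMap (v.adicCompletion F) (LocalRing E v) a),
      LemD1OfPlace.muOf E v c N J hcδ hδ hN hJh hJdet μ hμn hμc hμF ≠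
        LemD1OfPlace.muOf E v c N J hcδ hδ hN hJh hJdet 1 (one_mem_muSet_of_split E v c w hw).1
          (one_mem_muSet_of_split E v c w hw).2.1 (one_mem_muSet_of_split E v c w hw).2.2 := by
  obtain ⟨μ, hμn, hμc, hμF, hne⟩ := exists_mu_ne_one_of_split E v c w hw
  refine ⟨μ, hμn, hμc, fun a => iff_of_true (hμF a) (exists_mul_conjLocal_eq_algebraMap_of_split E v c w hw a),
    fun h => hne ?_⟩
  exact congrArg Subtype.val h

/-! ## §4 The carrier character `Λ = ν_w ∘ det ∘ pr_w` of `U(J)(F_v)` at a split place -/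

omit [Algebra.IsQuadraticExtension F E] in
include hJdet in
/-- `J` with `det J ≠ 0` is invertible at every place `w`. [folklore] -/
private theorem isUnit_placeForm_of_det_ne_zero (w : HeightOneSpectrum (𝓞 E)) : IsUnit (placeForm J w) :=
  isUnit_placeForm J ((Matrix.isUnit_iff_isUnit_det J).2 (Ne.isUnit hJdet)) w

/-- **the carrier character at a split place.**  There is a character `Λ` of the tree's `U(J)(F_v) = localPi E c N J v` —
namely `Λ = ν_w ∘ det ∘ pr_w` with `ν_w = ζ_N^{ord_w}` (§2), `pr_w = localPiSplitEquiv : U(J)(F_v) ≃ₜ* GL_N(E_w)` — which, read on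
`U(V)(F_v) = S.U` of the standing data AT THE PLACE MODEL along `LemD1OfPlace.uEquiv`: (i) is trivial on the centre `E_v¹`
(`S.scalar z ↦ ν_w(z_w^N) = 1`), (ii) is trivial on an open neighbourhood of `1` (`{ord_w det g_w = 0}`), (iii) is `≠ 1` at the element
with `w`-component `diag(ϖ_w, 1, …, 1)`. [cite: Mok2014, §1 Notation p. 5] -/
theorem exists_carrier_character_of_split (w : PlacesOver E v) (hw : c • w.1 ≠ w.1) :
    ∃ Λ : localPi E c N J v →* ℂˣ,
      (∀ z : (LemD1OfPlace.standingData E v c N J hcδ hδ hN hJh hJdet).normOne,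
        Λ (LemD1OfPlace.uEquiv E v c N J hcδ hδ hN hJh hJdet ((LemD1OfPlace.standingData E v c N J hcδ hδ hN hJh hJdet).scalar z)) = 1) ∧
      (∃ O : Set (LemD1OfPlace.standingData E v c N J hcδ hδ hN hJh hJdet).U, IsOpen O ∧ 1 ∈ O ∧
        ∀ g ∈ O, Λ (LemD1OfPlace.uEquiv E v c N J hcδ hδ hN hJh hJdet g) = 1) ∧
      ∃ g₀ : (LemD1OfPlace.standingData E v c N J hcδ hδ hN hJh hJdet).U,
        Λ (LemD1OfPlace.uEquiv E v c N J hcδ hδ hN hJh hJdet g₀) ≠ 1 := by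
  classical
  have hc : c ≠ 1 := hc_of_hw E v c hw
  have hJw : IsUnit (placeForm J w.1) := isUnit_placeForm_of_det_ne_zero E N J hJdet w.1
  set S := LemD1OfPlace.standingData E v c N J hcδ hδ hN hJh hJdet with hS
  -- the `w`-component of the determinant, read on `S.U` along `uEquiv`
  let dw : S.U → w.1.adicCompletion E := fun g =>
    Matrix.det ((((LemD1OfPlace.uEquiv E v c N J hcδ hδ hN hJh hJdet g : localPi E c N J v) : LocalGLPi E N v) w :
      GL (Fin N) (w.1.adicCompletion E)) : Matrix (Fin N) (Fin N) (w.1.adicCompletion E))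
  have hdw : ∀ g : S.U, dw g = ((Matrix.GeneralLinearGroup.det
      (((LemD1OfPlace.uEquiv E v c N J hcδ hδ hN hJh hJdet g : localPi E c N J v) : LocalGLPi E N v) w) :
        (w.1.adicCompletion E)ˣ) : w.1.adicCompletion E) := fun g => by
    rw [Matrix.GeneralLinearGroup.val_det_apply]
  have hcont : Continuous dw :=
    ((Units.continuous_val.comp ((continuous_apply w).comp (continuous_subtype_val.comp
      (LemD1OfPlace.uEquiv E v c N J hcδ hδ hN hJh hJdet).continuous)))).matrix_det
  obtain ⟨ν, -, -, hνone, hνN, ϖ, -, hϖ⟩ := exists_unramified_character E w.1 hN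
  let pr : localPi E c N J v ≃ₜ* GL (Fin N) (w.1.adicCompletion E) := localPiSplitEquiv c J hc hJh w hw hJw
  let Λ : localPi E c N J v →* ℂˣ := ν.comp (Matrix.GeneralLinearGroup.det.comp pr.toMulEquiv.toMonoidHom)
  have hΛ : ∀ g : localPi E c N J v, Λ g = ν (Matrix.GeneralLinearGroup.det ((g : LocalGLPi E N v) w)) := fun g => rfl
  refine ⟨Λ, fun z => ?_, ?_, ?_⟩
  · -- (i) the centre: `(uEquiv (scalar z))_w = z_w · 1_N`, `det = z_w ^ N`, `ν^N = 1`
    have hdet : Matrix.GeneralLinearGroup.det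
        (((LemD1OfPlace.uEquiv E v c N J hcδ hδ hN hJh hJdet (S.scalar z) : localPi E c N J v) : LocalGLPi E N v) w) =
        (Units.map (Pi.evalRingHom (fun w' : PlacesOver E v => w'.1.adicCompletion E) w).toMonoidHom
          ((z : (LocalRing E v)ˣ))) ^ N := by
      apply Units.ext
      rw [Matrix.GeneralLinearGroup.val_det_apply, Units.val_pow_eq_pow_val, Units.coe_map]
      change (((((S.scalar z : S.U) : GL (Fin N) (LocalRing E v)) : Matrix (Fin N) (Fin N) (LocalRing E v))).map
        (Pi.evalRingHom (fun w' : PlacesOver E v => w'.1.adicCompletion E) w)).det = _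
      rw [OscillatorStandingData.coe_scalar, Matrix.scalar_apply, Matrix.diagonal_map (map_zero _), Matrix.det_diagonal,
        Finset.prod_const, Finset.card_univ, Fintype.card_fin]
      rfl
    rw [hΛ, hdet, map_pow, hνN]
  · -- (ii) the open neighbourhood `{ord_w det g_w = 0}` of `1`
    refine ⟨{g : S.U | Valued.v (dw g) = 1}, ?_, ?_, ?_⟩
    · have hO : IsOpen {y : w.1.adicCompletion E | Valued.v y = 1} := by
        rw [isOpen_iff_mem_nhds]
        intro y hy
        have hy' : Valued.v y ≠ 0 := by
          rw [Set.mem_setOf_eq] at hy; rw [hy]; exact one_ne_zero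
        have hnh := Valued.locally_const hy'
        rw [Set.mem_setOf_eq] at hy
        rw [hy] at hnh
        exact hnh
      exact hO.preimage hcont
    · rw [Set.mem_setOf_eq, hdw, map_one, OneMemClass.coe_one, Pi.one_apply, map_one, Units.val_one, map_one]
    · intro g hg
      rw [Set.mem_setOf_eq, hdw] at hg
      rw [hΛ]
      exact hνone _ hg
  · -- (iii) the witness with `w`-component `diag(ϖ, 1, …, 1)`
    let i₀ : Fin N := ⟨0, by omega⟩
    let d : Fin N → w.1.adicCompletion E := fun i => if i = i₀ then (ϖ : w.1.adicCompletion E) else 1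
    have hd : (Matrix.diagonal d).det = (ϖ : w.1.adicCompletion E) := by
      rw [Matrix.det_diagonal, Finset.prod_ite_eq']
      simp
    have hd0 : (Matrix.diagonal d).det ≠ 0 := by rw [hd]; exact ϖ.ne_zero
    let D : GL (Fin N) (w.1.adicCompletion E) := Matrix.GeneralLinearGroup.mkOfDetNeZero _ hd0
    have hD : Matrix.GeneralLinearGroup.det D = ϖ := Units.ext (by
      rw [Matrix.GeneralLinearGroup.val_det_apply]; exact hd)
    refine ⟨(LemD1OfPlace.uEquiv E v c N J hcδ hδ hN hJh hJdet).symm (pr.symm D), ?_⟩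
    rw [ContinuousMulEquiv.apply_symm_apply]
    change ν (Matrix.GeneralLinearGroup.det (pr (pr.symm D))) ≠ 1
    rw [ContinuousMulEquiv.apply_symm_apply, hD]
    exact hϖ

/-! ## §5 [Lem. D.1, first sentence + (1)] AS PRINTED holds at the junction datum `LemD1OfPlace.data` on a line, at a split place -/

section Generic

/-- For a datum whose carrier `ω(μ, ε)` is the line `ℂ` with `U(V)(F)` acting through a character `λ` that agrees with
`χ` on the centre `E¹`, the `χ`-augmentation submodule vanishes: the maximal `χ`-quotient `ω(μ, ε, χ)` is the line itself.
[folklore] -/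
private theorem augmentation_eq_bot_of_character {F₀ E₀ : Type} [Field F₀] [ValuativeRel F₀] [TopologicalSpace F₀]
    [CommRing E₀] [Algebra F₀ E₀] [TopologicalSpace E₀] {n : ℕ} (L : LemD1Data F₀ E₀ n ℂ) (lam : L.S.U →* ℂˣ)
    (hω : ∀ (g : L.S.U) (x : ℂ), L.omega g x = (lam g : ℂ) * x)
    (hcen : ∀ z : L.S.normOne, lam (L.S.scalar z) = L.chi z) :
    augmentation L.omega L.S.scalar L.chi = ⊥ := by
  unfold augmentation
  refine iSup_eq_bot.2 fun z => ?_
  rw [LinearMap.range_eq_bot]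
  ext
  simp [hω, hcen]

/-- Two lines `ℂ` on which a group acts through characters `λ₁` and `1`, with `λ₁ g₀ ≠ 1` for some `g₀`, have NON-isomorphic
maximal `χ`-quotients (the first quotient being the line itself): an intertwining equivalence would carry the non-zero vector
`1` to a vector fixed by `g₀` and multiplied by `λ₁ g₀` at once. [folklore] -/
private theorem not_areIsomorphicRep_quotRep_of_character {G Z : Type*} [Group G] [Group Z]
    (ρ₁ ρ₀ : Representation ℂ G ℂ) {ζ : Z →* G} (hζ : ∀ z, ζ z ∈ Subgroup.center G) (χ₁ χ₀ : Z →* ℂˣ)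
    (lam : G →* ℂˣ) (h₁ : ∀ (g : G) (x : ℂ), ρ₁ g x = (lam g : ℂ) * x) (h₀ : ∀ (g : G) (x : ℂ), ρ₀ g x = x)
    (hN₁ : augmentation ρ₁ ζ χ₁ = ⊥) {g₀ : G} (hg₀ : lam g₀ ≠ 1) :
    ¬ AreIsomorphicRep (quotRep ρ₁ hζ χ₁) (quotRep ρ₀ hζ χ₀) := by
  rintro ⟨f, hf⟩
  have hw0 : (Submodule.Quotient.mk 1 : ℂ ⧸ augmentation ρ₁ ζ χ₁) ≠ 0 := by
    rw [Ne, Submodule.Quotient.mk_eq_zero, hN₁, Submodule.mem_bot]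
    exact one_ne_zero
  have h1 : quotRep ρ₁ hζ χ₁ g₀ (Submodule.Quotient.mk 1) =
      (lam g₀ : ℂ) • (Submodule.Quotient.mk 1 : ℂ ⧸ augmentation ρ₁ ζ χ₁) := by
    rw [quotRep_mk, h₁, ← smul_eq_mul, Submodule.Quotient.mk_smul]
  have h2 : ∀ y : ℂ ⧸ augmentation ρ₀ ζ χ₀, quotRep ρ₀ hζ χ₀ g₀ y = y := by
    intro y
    obtain ⟨u, rfl⟩ := Submodule.Quotient.mk_surjective _ y
    rw [quotRep_mk, h₀]
  have key := hf g₀ (Submodule.Quotient.mk 1)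
  rw [h1, h2, map_smul] at key
  have hsub : ((lam g₀ : ℂ) - 1) • f (Submodule.Quotient.mk 1) = 0 := by
    rw [sub_smul, one_smul, key, sub_self]
  rcases smul_eq_zero.1 hsub with h | h
  · exact hg₀ (Units.ext (sub_eq_zero.1 h))
  · exact hw0 (f.injective (by rw [h, map_zero]))

end Generic

variable (J₁ : Matrix (Fin 1) (Fin 1) E)

/-- **[Liu2021, App. D, Lem. D.1, first sentence + (1)] AS PRINTED HOLDS — at a split place — at the tree's junction datum
`LemD1OfPlace.data` (the type former of the displayed row `hD1''`) ON THE TRIVIAL LINE**: for EVERY Step-2 datum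
`μ, hμn, hμc, hμF`, every `J₁`, the centre character `χ = 1` of `U(J₁)(F_v)` and the carrier `ω = 1` on `ℂ`, the maximal
`χ`-quotient is the line itself — irreducible, admissible, NON-ZERO — while «`E` is a field» FAILS for `E_v` (§1): both sides of
the printed equivalence (1) are false, and the record holds.  (Same `F_v`, `E_v`, `S`, `ε`, `μ` slots as the displayed row; only
the carrier and `χ` differ.) [cite: Liu2021, App. D Lemma D.1 (1)] -/
theorem lemD1_1AsPrinted_data_trivial_of_split (w : PlacesOver E v) (hw : c • w.1 ≠ w.1)
    (μ : (LocalRing E v)ˣ →* ℂˣ) (hμn : ∀ x, ‖((μ x : ℂˣ) : ℂ)‖ = 1) (hμc : Continuous fun x => ((μ x : ℂˣ) : ℂ))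
    (hμF : ∀ a : (v.adicCompletion F)ˣ,
      μ (Units.map (algebraMap (v.adicCompletion F) (LocalRing E v)).toMonoidHom a) = 1 ↔
        ∃ x : (LocalRing E v)ˣ, (x : LocalRing E v) * conjLocal E c v x =
          algebraMap (v.adicCompletion F) (LocalRing E v) a)
    (h1n : ∀ h : localPi E c 1 J₁ v, ‖(((1 : localPi E c 1 J₁ v →* ℂˣ) h : ℂˣ) : ℂ)‖ = 1)
    (h1c : Continuous fun h : localPi E c 1 J₁ v => (((1 : localPi E c 1 J₁ v →* ℂˣ) h : ℂˣ) : ℂ)) :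
    LemD1_1AsPrinted (LemD1OfPlace.data E v c N J hcδ hδ hN hJh hJdet J₁
      (Representation.trivial ℂ (localPi E c N J v) ℂ) μ hμn hμc hμF 1 h1n h1c) :=
  LemD1IndexedNonVacuity.lemD1_1AsPrinted_of_character _ 1
    (fun g x => by rw [MonoidHom.one_apply, Units.val_one, one_mul]; rfl) (fun z => rfl)
    ⟨Set.univ, isOpen_univ, Set.mem_univ _, fun g _ => rfl⟩ (not_isField_localRing_of_split E v c w hw)

/-- **[Liu2021, App. D, Lem. D.1, first sentence + (1)] AS PRINTED HOLDS — at a split place — at the junction datum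
`LemD1OfPlace.data` ON A NON-TRIVIAL CHARACTER LINE**: there is a one-dimensional representation `ω` of the tree's
`U(J)(F_v) = localPi E c N J v` (the line of `Λ = ν_w ∘ det ∘ pr_w`, §4), NOT trivial, such that for EVERY Step-2 datum
`μ, hμn, hμc, hμF`, every `J₁` and `χ = 1`, the record `LemD1_1AsPrinted (LemD1OfPlace.data … J₁ ω μ hμn hμc hμF 1 h1n h1c)` holds
(the `χ`-quotient is the line: irreducible, admissible — the stabilisers contain the open set `{ord_w det g_w = 0}` —, non-zero;
«`E` is a field» fails). [cite: Liu2021, App. D Lemma D.1 (1)] -/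
theorem exists_lemD1_1AsPrinted_data_of_split (w : PlacesOver E v) (hw : c • w.1 ≠ w.1) :
    ∃ ω : Representation ℂ (localPi E c N J v) ℂ, (∃ g, ω g 1 ≠ 1) ∧
      ∀ (μ : (LocalRing E v)ˣ →* ℂˣ) (hμn : ∀ x, ‖((μ x : ℂˣ) : ℂ)‖ = 1) (hμc : Continuous fun x => ((μ x : ℂˣ) : ℂ))
        (hμF : ∀ a : (v.adicCompletion F)ˣ,
          μ (Units.map (algebraMap (v.adicCompletion F) (LocalRing E v)).toMonoidHom a) = 1 ↔
            ∃ x : (LocalRing E v)ˣ, (x : LocalRing E v) * conjLocal E c v x =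
              algebraMap (v.adicCompletion F) (LocalRing E v) a)
        (h1n : ∀ h : localPi E c 1 J₁ v, ‖(((1 : localPi E c 1 J₁ v →* ℂˣ) h : ℂˣ) : ℂ)‖ = 1)
        (h1c : Continuous fun h : localPi E c 1 J₁ v => (((1 : localPi E c 1 J₁ v →* ℂˣ) h : ℂˣ) : ℂ)),
        LemD1_1AsPrinted (LemD1OfPlace.data E v c N J hcδ hδ hN hJh hJdet J₁ ω μ hμn hμc hμF 1 h1n h1c) := by
  obtain ⟨Λ, hcen, ⟨O, hO, h1O, hOΛ⟩, g₀, hg₀⟩ := exists_carrier_character_of_split E v c N J hcδ hδ hN hJh hJdet w hw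
  let ω : Representation ℂ (localPi E c N J v) ℂ := (DistribMulAction.toModuleEnd ℂ ℂ).comp Λ
  have hω : ∀ (g : localPi E c N J v) (x : ℂ), ω g x = (Λ g : ℂ) * x := fun g x => by
    change (Λ g : ℂˣ) • x = _
    rw [Units.smul_def, smul_eq_mul]
  refine ⟨ω, ⟨LemD1OfPlace.uEquiv E v c N J hcδ hδ hN hJh hJdet g₀, fun h => hg₀ (Units.ext ?_)⟩,
    fun μ hμn hμc hμF h1n h1c => ?_⟩
  · rw [hω, mul_one] at h
    rw [h, Units.val_one]
  · exact LemD1IndexedNonVacuity.lemD1_1AsPrinted_of_character _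
      (Λ.comp (LemD1OfPlace.uEquiv E v c N J hcδ hδ hN hJh hJdet).toMulEquiv.toMonoidHom)
      (fun g x => hω _ x) (fun z => hcen z) ⟨O, hO, h1O, hOΛ⟩ (not_isField_localRing_of_split E v c w hw)

/-! ## §6 The certificate: «(1) for every member ∧ (3)» on a two-member collection over the place model, `μ₀ = 1 ≠ μ₁` -/

/-- **The hypothesis pair «[Liu2021, Lem. D.1 (1)] for every member ∧ [Lem. D.1 (3)]» of the indexed reading is jointly
satisfiable AT THE SLOT TYPES OF THE TREE'S PLACE MODEL, non-trivially in `μ`** (T5-style in-kernel certificate, our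
bookkeeping): for a quadratic extension `E/F` of number fields with `c δ = -δ ≠ 0`, any hermitian `J` with `det J ≠ 0`, any
`N ≥ 2`, a finite place `v` of `F` that SPLITS in `E` (`w ∣ v`, `c • w ≠ w`), and ANY Step-1 representative `e`, there is a
two-member collection `Lf : LemD1IndexedFamily F_v E_v N (Fin 2)` whose standing data IS `LemD1OfPlace.standingData E v c N J …`
(`Lf.S = …`), with `Lf.eps i = e`, `Lf.chi i = 1`, `Lf.mu 0 = 1` (packaged by `LemD1OfPlace.muOf`) and `Lf.mu 1 = μ₁` (§3), carriers
the trivial line and the line of `Λ` (§4) read on `S.U` along `uEquiv`, such that `Lf.Item1AsPrinted` (each `ω(μ_i, ε, χ)`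
irreducible, admissible, non-zero; both sides of (1) false) AND `LemD1_3AsPrintedI Lf` (the printed «isomorphic iff same
`(μ, ε, χ)`» for all four pairs) AND `Lf.mu 0 ≠ Lf.mu 1` AND `ω(μ₁, ε, χ) ≇ ω(1, ε, χ)`.  No statement about Liu's objects or the
tree's own local Weil carriers. [cite: Liu2021, App. D Lemma D.1 (1) and (3)] -/
theorem exists_lemD1IndexedFamily_of_split (w : PlacesOver E v) (hw : c • w.1 ≠ w.1)
    (e : LemD1.EpsRep (LemD1OfPlace.standingData E v c N J hcδ hδ hN hJh hJdet)) :
    ∃ Lf : LemD1IndexedFamily (v.adicCompletion F) (LocalRing E v) N (Fin 2),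
      Lf.S = LemD1OfPlace.standingData E v c N J hcδ hδ hN hJh hJdet ∧
      (∀ i, (Lf.eps i).1 = e.1) ∧ (∀ i, (Lf.chi i).1 = 1) ∧ (Lf.mu 0).1 = 1 ∧
      Lf.Item1AsPrinted ∧ LemD1_3AsPrintedI Lf ∧
      Lf.mu 0 ≠ Lf.mu 1 ∧ ¬ AreIsomorphicRep (Lf.quot 1) (Lf.quot 0) := by
  classical
  obtain ⟨e₁, he₁⟩ := e
  set S := LemD1OfPlace.standingData E v c N J hcδ hδ hN hJh hJdet with hS
  -- Step 2: `μ₀ = 1` and `μ₁ = λ (λ ∘ c)⁻¹`, both through the rows' packaging `LemD1OfPlace.muOf`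
  obtain ⟨μ₁r, hμ₁n, hμ₁c, hμ₁F, hne⟩ := exists_muOf_ne_muOf_one_of_split E v c N J hcδ hδ hN hJh hJdet w hw
  let μ₀ : LemD1.MuSet S := LemD1OfPlace.muOf E v c N J hcδ hδ hN hJh hJdet 1 (one_mem_muSet_of_split E v c w hw).1
    (one_mem_muSet_of_split E v c w hw).2.1 (one_mem_muSet_of_split E v c w hw).2.2
  let μ₁ : LemD1.MuSet S := LemD1OfPlace.muOf E v c N J hcδ hδ hN hJh hJdet μ₁r hμ₁n hμ₁c hμ₁F
  have hμne' : μ₀ ≠ μ₁ := fun h => hne h.symm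
  -- Step 3: `χ = 1` for both members
  let χ : LemD1.ChiSet S := ⟨1, fun z => by simp, by simpa using continuous_const⟩
  -- the carriers: the trivial line and the line of `Λ`, read on `S.U` along `uEquiv`
  obtain ⟨Λ, hcen, ⟨O, hO, h1O, hOΛ⟩, g₀, hg₀⟩ := exists_carrier_character_of_split E v c N J hcδ hδ hN hJh hJdet w hw
  let lam : S.U →* ℂˣ := Λ.comp (LemD1OfPlace.uEquiv E v c N J hcδ hδ hN hJh hJdet).toMulEquiv.toMonoidHom
  have hlam : ∀ g, lam g = Λ (LemD1OfPlace.uEquiv E v c N J hcδ hδ hN hJh hJdet g) := fun g => rfl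
  let ω₀ : Representation ℂ S.U ℂ := Representation.trivial ℂ S.U ℂ
  let ω₁ : Representation ℂ S.U ℂ := (DistribMulAction.toModuleEnd ℂ ℂ).comp lam
  have hω₀ : ∀ (g : S.U) (x : ℂ), ω₀ g x = x := fun g x => rfl
  have hω₁ : ∀ (g : S.U) (x : ℂ), ω₁ g x = (lam g : ℂ) * x := fun g x => by
    change (lam g : ℂˣ) • x = _
    rw [Units.smul_def, smul_eq_mul]
  have hcen₁ : ∀ z : S.normOne, lam (S.scalar z) = (1 : S.normOne →* ℂˣ) z := fun z => by
    rw [MonoidHom.one_apply, hlam]; exact hcen z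
  have hopen : ∃ O : Set S.U, IsOpen O ∧ (1 : S.U) ∈ O ∧ ∀ g ∈ O, lam g = 1 := ⟨O, hO, h1O, hOΛ⟩
  have hg₀' : lam g₀ ≠ 1 := hg₀
  -- the collection
  let Lf : LemD1IndexedFamily (v.adicCompletion F) (LocalRing E v) N (Fin 2) :=
    { isNonarchimedeanLocalField := inferInstance
      isModuleTopology := LemD1OfPlace.isModuleTopology_localRing E v
      S := S
      mu := ![μ₀, μ₁]
      eps := fun _ => ⟨e₁, he₁⟩
      chi := fun _ => χ
      V := fun _ => ℂ
      omega := ![ω₀, ω₁] }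
  have hμne : Lf.mu 0 ≠ Lf.mu 1 := hμne'
  -- `ω(μ₁, ε, χ) ≇ ω(μ₀, ε, χ)`
  have hN₁ : augmentation (Lf.single 1).omega (Lf.single 1).S.scalar (Lf.single 1).chi = ⊥ :=
    augmentation_eq_bot_of_character (Lf.single 1) lam hω₁ hcen₁
  have hnotiso : ¬ AreIsomorphicRep (Lf.quot 1) (Lf.quot 0) :=
    not_areIsomorphicRep_quotRep_of_character ω₁ ω₀ S.scalar_mem_center (1 : S.normOne →* ℂˣ) 1 lam hω₁ hω₀ hN₁ hg₀'
  -- Lemma D.1, first sentence + (1), member by member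
  have hItem1 : Lf.Item1AsPrinted := by
    intro i
    fin_cases i
    · exact LemD1IndexedNonVacuity.lemD1_1AsPrinted_of_character (Lf.single 0) 1
        (fun g x => by rw [MonoidHom.one_apply, Units.val_one, one_mul]; exact hω₀ g x) (fun z => rfl)
        ⟨Set.univ, isOpen_univ, Set.mem_univ _, fun g _ => rfl⟩ (not_isField_localRing_of_split E v c w hw)
    · exact LemD1IndexedNonVacuity.lemD1_1AsPrinted_of_character (Lf.single 1) lam hω₁ hcen₁ hopen
        (not_isField_localRing_of_split E v c w hw)
  -- Lemma D.1 (3), for all four pairs of members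
  have hrefl : ∀ k : Fin 2, (AreIsomorphicRep (Lf.quot k) (Lf.quot k) ↔
      (Lf.mu k = Lf.mu k ∧ LemD1.SameClass (Lf.eps k) (Lf.eps k) ∧ Lf.chi k = Lf.chi k)) :=
    fun k => iff_of_true (AreIsomorphicRep.refl _) ⟨rfl, ⟨1, by simp⟩, rfl⟩
  have hItem3 : LemD1_3AsPrintedI Lf := by
    intro _ i j
    fin_cases i <;> fin_cases j
    · exact hrefl 0
    · exact iff_of_false hnotiso fun h => hμne h.1.symm
    · exact iff_of_false (fun h => hnotiso h.symm) fun h => hμne h.1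
    · exact hrefl 1
  exact ⟨Lf, rfl, fun _ => rfl, fun _ => rfl, rfl, hItem1, hItem3, hμne, hnotiso⟩

/-- **Consequence**: at the slot types of the tree's place model (any quadratic `E/F`, any split `v`, any hermitian
non-degenerate `J`, `N ≥ 2`), the two displayed records read on an indexed collection do NOT by their shape force the collapse
«all members carry the same Step-2 character `μ`» (so a conclusion `μ_i = μ_j` drawn from them downstream — the cross-`μ`
separation — is not vacuous-by-collapse there), let alone `False`. [cite: Liu2021, App. D Lemma D.1 (1) and (3)] -/
theorem not_forall_mu_eq_of_split (w : PlacesOver E v) (hw : c • w.1 ≠ w.1) :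
    ¬ ∀ Lf : LemD1IndexedFamily (v.adicCompletion F) (LocalRing E v) N (Fin 2),
        Lf.S = LemD1OfPlace.standingData E v c N J hcδ hδ hN hJh hJdet →
        Lf.Item1AsPrinted → LemD1_3AsPrintedI Lf → ∀ i j : Fin 2, Lf.mu i = Lf.mu j := by
  intro h
  obtain ⟨Lf, hS, -, -, -, h1, h3, hne, -⟩ :=
    exists_lemD1IndexedFamily_of_split E v c N J hcδ hδ hN hJh hJdet w hw (LemD1OfPlace.epsDelta E v c N J hcδ hδ hN hJh hJdet)
  exact hne (h Lf hS h1 h3 0 1)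

/-! ## §7 Step 2 in general: `μ(a)² = 1` on `F^×`; odd powers and inverses of Step-2 characters are Step-2 characters -/

section MuSetGeneral

variable {F₀ E₀ : Type} [Field F₀] [CommRing E₀] [Algebra F₀ E₀] [TopologicalSpace E₀] {n₀ : ℕ}
  {S₀ : OscillatorStandingData F₀ E₀ n₀}

omit [TopologicalSpace E₀] in
/-- `ι(a) · ι(a)^c = ι(a²)` for `a ∈ F`: the element `ι(a²)` of `F^×` IS a norm (`c` fixes `F`). [cite: Liu2021, App. D §D.1 (l. 5213)] -/
private theorem algebraMap_mul_conj_algebraMap (a : F₀ˣ) :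
    ((Units.map (algebraMap F₀ E₀).toMonoidHom a : E₀ˣ) : E₀) * S₀.conj (Units.map (algebraMap F₀ E₀).toMonoidHom a : E₀ˣ) =
      algebraMap F₀ E₀ ((a * a : F₀ˣ) : F₀) := by
  change algebraMap F₀ E₀ (a : F₀) * S₀.conj (algebraMap F₀ E₀ (a : F₀)) = _
  rw [S₀.conj.commutes, Units.val_mul, map_mul]

/-- **for EVERY Step-2 character `μ` and every `a ∈ F^×`: `μ(a)² = 1`** — because `a² = a · a^c` is a norm from `E^×`, so the
printed clause «`μ|_{F^×}` has kernel exactly `Nm E^×`» gives `μ(a²) = 1`.  (Over ANY standing data of [Liu2021, §D.1]: the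
restriction `μ|_{F^×}` is a character of order `≤ 2`.) [cite: Liu2021, App. D §D.1 Step 2 (l. 5219)] -/
theorem muSet_apply_algebraMap_sq (μ : LemD1.MuSet S₀) (a : F₀ˣ) :
    μ.1 (Units.map (algebraMap F₀ E₀).toMonoidHom a) ^ 2 = 1 := by
  rw [← map_pow, pow_two, ← map_mul]
  exact (μ.2.2.2 (a * a)).2 ⟨Units.map (algebraMap F₀ E₀).toMonoidHom a, algebraMap_mul_conj_algebraMap a⟩

/-- **odd powers of a Step-2 character are Step-2 characters**: `μ^{2k+1}` has values in `ℂ^1`, is continuous, and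
`μ^{2k+1}(a) = μ(a) · (μ(a)²)^k = μ(a)` on `F^×`, so the printed kernel clause for `μ^{2k+1}` IS the clause for `μ`.  Stated as
an existence in the printed index set `MuSet S`. [cite: Liu2021, App. D §D.1 Step 2 (l. 5219)] -/
theorem exists_muSet_val_eq_pow_odd (μ : LemD1.MuSet S₀) (k : ℕ) :
    ∃ μ' : LemD1.MuSet S₀, μ'.1 = μ.1 ^ (2 * k + 1) := by
  refine ⟨⟨μ.1 ^ (2 * k + 1), fun x => ?_, ?_, fun a => ?_⟩, rfl⟩
  · rw [MonoidHom.pow_apply, Units.val_pow_eq_pow_val, norm_pow, μ.2.1 x, one_pow]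
  · have heq : (fun x : E₀ˣ => (((μ.1 ^ (2 * k + 1)) x : ℂˣ) : ℂ)) = fun x => (((μ.1 x : ℂˣ) : ℂ)) ^ (2 * k + 1) := by
      funext x; rw [MonoidHom.pow_apply, Units.val_pow_eq_pow_val]
    rw [heq]
    exact μ.2.2.1.pow _
  · rw [MonoidHom.pow_apply, pow_succ, pow_mul, muSet_apply_algebraMap_sq μ a, one_pow, one_mul]
    exact μ.2.2.2 a

/-- **the inverse of a Step-2 character is a Step-2 character** (`μ⁻¹(a) = 1 ↔ μ(a) = 1`). [cite: Liu2021, App. D §D.1 Step 2 (l. 5219)] -/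
theorem exists_muSet_val_eq_inv (μ : LemD1.MuSet S₀) : ∃ μ' : LemD1.MuSet S₀, μ'.1 = μ.1⁻¹ := by
  refine ⟨⟨μ.1⁻¹, fun x => ?_, ?_, fun a => ?_⟩, rfl⟩
  · rw [MonoidHom.inv_apply, Units.val_inv_eq_inv_val, norm_inv, μ.2.1 x, inv_one]
  · have heq : (fun x : E₀ˣ => (((μ.1⁻¹ : E₀ˣ →* ℂˣ) x : ℂˣ) : ℂ)) = fun x => ((((μ.1 x : ℂˣ) : ℂ)))⁻¹ := by
      funext x; rw [MonoidHom.inv_apply, Units.val_inv_eq_inv_val]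
    rw [heq]
    exact μ.2.2.1.inv₀ fun x => Units.ne_zero _
  · rw [MonoidHom.inv_apply, inv_eq_one]
    exact μ.2.2.2 a

/-- `μ ≠ μ³` iff `μ` is not quadratic (`μ(x)² ≠ 1` for some `x`). [cite: Liu2021, App. D §D.1 Step 2 (l. 5219)] -/
theorem muSet_val_ne_pow_three_iff (μ : LemD1.MuSet S₀) : μ.1 ≠ μ.1 ^ 3 ↔ ∃ x : E₀ˣ, μ.1 x ^ 2 ≠ 1 := by
  constructor
  · intro h
    by_contra hall
    apply h
    ext x
    have hx : μ.1 x ^ 2 = 1 := by_contra fun hx => hall ⟨x, hx⟩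
    rw [MonoidHom.pow_apply, pow_succ, hx, one_mul]
  · rintro ⟨x, hx⟩ h
    apply hx
    have := DFunLike.congr_fun h x
    rw [MonoidHom.pow_apply, pow_succ] at this
    exact (mul_eq_right.1 this.symm)

/-- **non-collapse of the printed index set from ONE non-quadratic Step-2 character** (over ANY standing data of §D.1, e.g. at
a NON-split place): if `μ ∈ MuSet S` has `μ(x)² ≠ 1` for some `x`, then `μ³ ∈ MuSet S` is a second, different element.
[cite: Liu2021, App. D §D.1 Step 2 (l. 5219)] -/
theorem exists_muSet_ne_of_sq_ne_one (μ : LemD1.MuSet S₀) (h : ∃ x : E₀ˣ, μ.1 x ^ 2 ≠ 1) :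
    ∃ μ' : LemD1.MuSet S₀, μ' ≠ μ ∧ μ'.1 = μ.1 ^ 3 := by
  obtain ⟨μ', hμ'⟩ := exists_muSet_val_eq_pow_odd μ 1
  refine ⟨μ', fun heq => (muSet_val_ne_pow_three_iff μ).2 h ?_, hμ'⟩
  rw [← hμ', heq]

end MuSetGeneral

/-! ## §8 At EVERY finite place (split or not), rank `N ≠ 2`: the `hD1''` type former on the trivial line, and the teeth of (3) -/

section AnyPlace

/-- **Item (1) AS PRINTED holds at a character datum of rank `n ≠ 2`** (both sides of (1) false, the right one through its
conjunct «(in particular `n = 2`)»; the maximal `χ`-quotient is the line: irreducible, admissible, non-zero).  Private twin of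
`LemD1IndexedNonVacuityNonsplit.lemD1_1AsPrinted_of_character_of_rank_ne_two` (kept private here to keep this file's import
closure free of the `ℚ₃(i)` leaf). [cite: Liu2021, App. D Lemma D.1 (1) (l. 5229)] -/
private theorem lemD1_1AsPrinted_of_character_of_rank_ne_two' {F₀ E₀ : Type} [Field F₀] [ValuativeRel F₀]
    [TopologicalSpace F₀] [CommRing E₀] [Algebra F₀ E₀] [TopologicalSpace E₀] [IsTopologicalRing E₀] {n₀ : ℕ}
    (L : LemD1Data F₀ E₀ n₀ ℂ) (lam : L.S.U →* ℂˣ) (hω : ∀ (g : L.S.U) (x : ℂ), L.omega g x = (lam g : ℂ) * x)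
    (hcen : ∀ z : L.S.normOne, lam (L.S.scalar z) = L.chi z)
    (hopen : ∃ O : Set L.S.U, IsOpen O ∧ (1 : L.S.U) ∈ O ∧ ∀ g ∈ O, lam g = 1) (hn : n₀ ≠ 2) :
    LemD1_1AsPrinted L := by
  have hN : augmentation L.omega L.S.scalar L.chi = ⊥ := augmentation_eq_bot_of_character L lam hω hcen
  have hfin : Module.finrank ℂ (ℂ ⧸ augmentation L.omega L.S.scalar L.chi) = 1 := by
    rw [(Submodule.quotEquivOfEqBot _ hN).finrank_eq, Module.finrank_self]
  haveI hsimple : IsSimpleModule ℂ (ℂ ⧸ augmentation L.omega L.S.scalar L.chi) :=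
    isSimpleModule_iff_finrank_eq_one.2 hfin
  have hact : ∀ (g : L.S.U) (w : ℂ ⧸ augmentation L.omega L.S.scalar L.chi),
      L.datum.quot g w = (lam g : ℂ) • w := by
    intro g w
    obtain ⟨y, rfl⟩ := Submodule.Quotient.mk_surjective _ w
    rw [LemD1Data.datum_quot, quotRep_mk, hω, ← smul_eq_mul, Submodule.Quotient.mk_smul]
  refine ⟨⟨?_, ?_, ?_⟩, ?_⟩
  · intro W
    rcases eq_bot_or_eq_top W.toSubmodule with h | h
    · exact Or.inl (Subrepresentation.toSubmodule_injective h)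
    · exact Or.inr (Subrepresentation.toSubmodule_injective h)
  · intro x
    obtain ⟨O, hO, h1O, hlam⟩ := hopen
    change IsOpen (L.datum.quot.stabilizerSubgroup x : Set L.S.U)
    refine Subgroup.isOpen_of_mem_nhds _ (g := 1) (Filter.mem_of_superset (hO.mem_nhds h1O) fun g hg => ?_)
    change L.datum.quot g x = x
    rw [hact, hlam g hg, Units.val_one, one_smul]
  · intro K _
    infer_instance
  · refine iff_of_false ?_ ?_
    · rw [not_subsingleton_iff_nontrivial]
      exact Module.nontrivial_of_finrank_pos (R := ℂ) (by rw [hfin]; exact one_pos)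
    · exact fun h => hn h.2.1.2

/-- **[Liu2021, App. D, Lem. D.1, first sentence + (1)] AS PRINTED HOLDS AT EVERY FINITE PLACE `v` (split or not) at the
junction datum `LemD1OfPlace.data` on the trivial line, for rank `N ≠ 2`** — for EVERY Step-2 datum `μ, hμn, hμc, hμF`
(e.g. the displayed rows' `localMu` with its three displayed proofs), every `J₁`, `χ = 1`, `ω = 1` on `ℂ`: the maximal
`χ`-quotient is the non-zero line (irreducible, admissible), and the printed right-hand side of (1) fails through «`n = 2`».
This is the type former of the displayed `hD1''` (`localLemD1Data = LemD1OfPlace.data …`, rank `3`) inhabited AT EVERY PLACE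
with the rows' own `F_v ∕ E_v ∕ S ∕ ε ∕ μ` slots and only the carrier and `χ` changed. [cite: Liu2021, App. D Lemma D.1 (1) (l. 5229)] -/
theorem lemD1_1AsPrinted_data_trivial_of_rank_ne_two (hN2 : N ≠ 2)
    (μ : (LocalRing E v)ˣ →* ℂˣ) (hμn : ∀ x, ‖((μ x : ℂˣ) : ℂ)‖ = 1) (hμc : Continuous fun x => ((μ x : ℂˣ) : ℂ))
    (hμF : ∀ a : (v.adicCompletion F)ˣ,
      μ (Units.map (algebraMap (v.adicCompletion F) (LocalRing E v)).toMonoidHom a) = 1 ↔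
        ∃ x : (LocalRing E v)ˣ, (x : LocalRing E v) * conjLocal E c v x =
          algebraMap (v.adicCompletion F) (LocalRing E v) a)
    (h1n : ∀ h : localPi E c 1 J₁ v, ‖(((1 : localPi E c 1 J₁ v →* ℂˣ) h : ℂˣ) : ℂ)‖ = 1)
    (h1c : Continuous fun h : localPi E c 1 J₁ v => (((1 : localPi E c 1 J₁ v →* ℂˣ) h : ℂˣ) : ℂ)) :
    LemD1_1AsPrinted (LemD1OfPlace.data E v c N J hcδ hδ hN hJh hJdet J₁
      (Representation.trivial ℂ (localPi E c N J v) ℂ) μ hμn hμc hμF 1 h1n h1c) :=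
  lemD1_1AsPrinted_of_character_of_rank_ne_two' _ 1
    (fun g x => by rw [MonoidHom.one_apply, Units.val_one, one_mul]; rfl) (fun z => rfl)
    ⟨Set.univ, isOpen_univ, Set.mem_univ _, fun g _ => rfl⟩ hN2

/-- **at EVERY finite place, the Step-2 index set of the place model has two elements through the rows' packaging
`LemD1OfPlace.muOf` as soon as the given Step-2 datum `μ` is not quadratic** (`μ(x)² ≠ 1` for some `x`; the second element is
`μ³`, §7). [cite: Liu2021, App. D §D.1 Step 2 (l. 5219)] -/
theorem exists_muOf_ne_of_sq_ne_one
    (μ : (LocalRing E v)ˣ →* ℂˣ) (hμn : ∀ x, ‖((μ x : ℂˣ) : ℂ)‖ = 1) (hμc : Continuous fun x => ((μ x : ℂˣ) : ℂ))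
    (hμF : ∀ a : (v.adicCompletion F)ˣ,
      μ (Units.map (algebraMap (v.adicCompletion F) (LocalRing E v)).toMonoidHom a) = 1 ↔
        ∃ x : (LocalRing E v)ˣ, (x : LocalRing E v) * conjLocal E c v x =
          algebraMap (v.adicCompletion F) (LocalRing E v) a)
    (hμ2 : ∃ x : (LocalRing E v)ˣ, μ x ^ 2 ≠ 1) :
    ∃ (μ' : (LocalRing E v)ˣ →* ℂˣ) (hμ'n : ∀ x, ‖((μ' x : ℂˣ) : ℂ)‖ = 1) (hμ'c : Continuous fun x => ((μ' x : ℂˣ) : ℂ))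
      (hμ'F : ∀ a : (v.adicCompletion F)ˣ,
        μ' (Units.map (algebraMap (v.adicCompletion F) (LocalRing E v)).toMonoidHom a) = 1 ↔
          ∃ x : (LocalRing E v)ˣ, (x : LocalRing E v) * conjLocal E c v x =
            algebraMap (v.adicCompletion F) (LocalRing E v) a),
      μ' = μ ^ 3 ∧
      LemD1OfPlace.muOf E v c N J hcδ hδ hN hJh hJdet μ' hμ'n hμ'c hμ'F ≠
        LemD1OfPlace.muOf E v c N J hcδ hδ hN hJh hJdet μ hμn hμc hμF := by
  obtain ⟨μ', hne, hμ'⟩ := exists_muSet_ne_of_sq_ne_one (LemD1OfPlace.muOf E v c N J hcδ hδ hN hJh hJdet μ hμn hμc hμF) hμ2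
  exact ⟨μ'.1, μ'.2.1, μ'.2.2.1, μ'.2.2.2, hμ', hne⟩

/-- **the teeth of [Lem. D.1 (3)] AS PRINTED at the place model, at EVERY finite place** (rank `N ≥ 3`): given a NON-quadratic
Step-2 datum `μ` (with its three displayed proofs) and any Step-1 representative `e`, the two-member collection with labels
`(μ, e, 1)`, `(μ³, e, 1)` and BOTH carriers the trivial line satisfies (1) for every member (§8, rank `≠ 2`) but VIOLATES (3):
its two `ω`'s are isomorphic (equal) while `μ ≠ μ³`.  So the displayed record `LemD1_3AsPrintedI` is not true-by-shape at the
rows' slot types: it REJECTS carriers that do not separate distinct Step-2 characters. [cite: Liu2021, App. D Lemma D.1 (1) and (3)] -/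
theorem exists_lemD1IndexedFamily_item1_not_lemD1_3_of_sq_ne_one (h3 : 3 ≤ N)
    (μ : (LocalRing E v)ˣ →* ℂˣ) (hμn : ∀ x, ‖((μ x : ℂˣ) : ℂ)‖ = 1) (hμc : Continuous fun x => ((μ x : ℂˣ) : ℂ))
    (hμF : ∀ a : (v.adicCompletion F)ˣ,
      μ (Units.map (algebraMap (v.adicCompletion F) (LocalRing E v)).toMonoidHom a) = 1 ↔
        ∃ x : (LocalRing E v)ˣ, (x : LocalRing E v) * conjLocal E c v x =
          algebraMap (v.adicCompletion F) (LocalRing E v) a)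
    (hμ2 : ∃ x : (LocalRing E v)ˣ, μ x ^ 2 ≠ 1)
    (e : LemD1.EpsRep (LemD1OfPlace.standingData E v c N J hcδ hδ hN hJh hJdet)) :
    ∃ Lf : LemD1IndexedFamily (v.adicCompletion F) (LocalRing E v) N (Fin 2),
      Lf.S = LemD1OfPlace.standingData E v c N J hcδ hδ hN hJh hJdet ∧
      (∀ i, (Lf.eps i).1 = e.1) ∧ (∀ i, (Lf.chi i).1 = 1) ∧ (Lf.mu 0).1 = μ ∧ (Lf.mu 1).1 = μ ^ 3 ∧
      Lf.Item1AsPrinted ∧ Lf.mu 0 ≠ Lf.mu 1 ∧ ¬ LemD1_3AsPrintedI Lf := by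
  classical
  obtain ⟨e₁, he₁⟩ := e
  have hN2 : N ≠ 2 := by omega
  set S := LemD1OfPlace.standingData E v c N J hcδ hδ hN hJh hJdet with hS
  let μ₀ : LemD1.MuSet S := LemD1OfPlace.muOf E v c N J hcδ hδ hN hJh hJdet μ hμn hμc hμF
  obtain ⟨μ₁, hne, hμ₁⟩ := exists_muSet_ne_of_sq_ne_one μ₀ hμ2
  let χ : LemD1.ChiSet S := ⟨1, fun z => by simp, by simpa using continuous_const⟩
  let ω₀ : Representation ℂ S.U ℂ := Representation.trivial ℂ S.U ℂ
  have hω₀ : ∀ (g : S.U) (x : ℂ), ω₀ g x = ((1 : S.U →* ℂˣ) g : ℂ) * x := fun g x => by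
    rw [MonoidHom.one_apply, Units.val_one, one_mul]; rfl
  let Lf : LemD1IndexedFamily (v.adicCompletion F) (LocalRing E v) N (Fin 2) :=
    { isNonarchimedeanLocalField := inferInstance
      isModuleTopology := LemD1OfPlace.isModuleTopology_localRing E v
      S := S
      mu := ![μ₀, μ₁]
      eps := fun _ => ⟨e₁, he₁⟩
      chi := fun _ => χ
      V := fun _ => ℂ
      omega := fun _ => ω₀ }
  have hμne : Lf.mu 0 ≠ Lf.mu 1 := fun h => hne h.symm
  have hItem1 : Lf.Item1AsPrinted := fun i =>
    lemD1_1AsPrinted_of_character_of_rank_ne_two' (Lf.single i) 1 hω₀ (fun z => rfl)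
      ⟨Set.univ, isOpen_univ, Set.mem_univ _, fun g _ => rfl⟩ hN2
  have hnot3 : ¬ LemD1_3AsPrintedI Lf := fun h => hμne ((h h3 0 1).1 (AreIsomorphicRep.refl _)).1.symm
  exact ⟨Lf, rfl, fun _ => rfl, fun _ => rfl, rfl, hμ₁, hItem1, hμne, hnot3⟩

end AnyPlace

/-! ## §9 (v3) At EVERY split place a NON-QUADRATIC Step-2 character exists: the hypothesis `∃ x, μ(x)² ≠ 1` of §8 is
discharged at split places, so [Lem. D.1 (3)] AS PRINTED is violated there by a two-`μ`-label trivial-carrier collection -/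

section SplitNonQuadratic

omit [Algebra.IsQuadraticExtension F E] in
open scoped Classical in
/-- the Step-2 character `μ = λ · (λ ∘ (c ⊗ 1))⁻¹`, `λ = ν ∘ pr_w`, attached to ANY unitary continuous character `ν` of `E_wˣ` at a
split place: unitary, continuous, trivial on `ι_v(F_vˣ)`, and equal to `ν(ϖ)` at the unit `(ϖ at w, 1 at w̄)` for every `ϖ ∈ E_wˣ`.
[cite: Liu2021, App. D §D.1 Step 2 (l. 5219)] -/
private theorem exists_mu_apply_single_of_split (w : PlacesOver E v) (hw : c • w.1 ≠ w.1) (ν : (w.1.adicCompletion E)ˣ →* ℂˣ)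
    (hνnorm : ∀ x, ‖((ν x : ℂˣ) : ℂ)‖ = 1) (hνcont : Continuous fun x : (w.1.adicCompletion E)ˣ => ((ν x : ℂˣ) : ℂ)) :
    ∃ μ : (LocalRing E v)ˣ →* ℂˣ,
      (∀ x, ‖((μ x : ℂˣ) : ℂ)‖ = 1) ∧ (Continuous fun x => ((μ x : ℂˣ) : ℂ)) ∧
      (∀ a : (v.adicCompletion F)ˣ, μ (Units.map (algebraMap (v.adicCompletion F) (LocalRing E v)).toMonoidHom a) = 1) ∧
      ∀ ϖ : (w.1.adicCompletion E)ˣ,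
        μ (MulEquiv.piUnits.symm (Pi.mulSingle w ϖ : ∀ w' : PlacesOver E v, (w'.1.adicCompletion E)ˣ)) = ν ϖ := by
  classical
  let prw : (LocalRing E v)ˣ →* (w.1.adicCompletion E)ˣ :=
    Units.map (Pi.evalRingHom (fun w' : PlacesOver E v => w'.1.adicCompletion E) w).toMonoidHom
  let κ : (LocalRing E v)ˣ →* (LocalRing E v)ˣ := Units.map (conjLocal E c v).toMonoidHom
  let lam : (LocalRing E v)ˣ →* ℂˣ := ν.comp prw
  have hlam : ∀ x, lam x = ν (prw x) := fun x => rfl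
  let μ : (LocalRing E v)ˣ →* ℂˣ := lam * (lam.comp κ)⁻¹
  have hμ : ∀ x, μ x = lam x * (lam (κ x))⁻¹ := fun x => rfl
  refine ⟨μ, fun x => ?_, ?_, fun a => ?_, fun ϖ => ?_⟩
  · rw [hμ, Units.val_mul, Units.val_inv_eq_inv_val, norm_mul, norm_inv, hlam, hlam, hνnorm, hνnorm, inv_one, mul_one]
  · have hc1 : Continuous fun x : (LocalRing E v)ˣ => ((lam x : ℂˣ) : ℂ) :=
      hνcont.comp (Continuous.units_map _ (continuous_apply w))
    have hc2 : Continuous fun x : (LocalRing E v)ˣ => ((lam (κ x) : ℂˣ) : ℂ) :=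
      hc1.comp (Continuous.units_map _ (continuous_conjLocal E c v))
    have heq : (fun x : (LocalRing E v)ˣ => ((μ x : ℂˣ) : ℂ)) =
        fun x => ((lam x : ℂˣ) : ℂ) * (((lam (κ x) : ℂˣ) : ℂ))⁻¹ := by
      funext x; rw [hμ, Units.val_mul, Units.val_inv_eq_inv_val]
    rw [heq]
    exact hc1.mul (hc2.inv₀ fun x => Units.ne_zero _)
  · have hκ : κ (Units.map (algebraMap (v.adicCompletion F) (LocalRing E v)).toMonoidHom a) =
        Units.map (algebraMap (v.adicCompletion F) (LocalRing E v)).toMonoidHom a := by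
      apply Units.ext
      change conjLocal E c v (algebraMap (v.adicCompletion F) (LocalRing E v) (a : v.adicCompletion F)) = _
      rw [algebraMap_localRing_eq, conjLocal_toLocalRing]
      rfl
    rw [hμ, hκ, mul_inv_cancel]
  · set z : (LocalRing E v)ˣ := MulEquiv.piUnits.symm (Pi.mulSingle w ϖ) with hzdef
    have hz : ∀ w' : PlacesOver E v, (z : LocalRing E v) w' =
        (((Pi.mulSingle w ϖ : ∀ w'' : PlacesOver E v, (w''.1.adicCompletion E)ˣ) w' : (w'.1.adicCompletion E)ˣ) :
          w'.1.adicCompletion E) :=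
      fun w' => rfl
    have h1 : prw z = ϖ := by
      apply Units.ext
      change (z : LocalRing E v) w = _
      rw [hz, Pi.mulSingle_eq_same]
    have h2 : prw (κ z) = 1 := by
      apply Units.ext
      change conjLocal E c v (z : LocalRing E v) w = 1
      rw [conjLocal_apply, hz ⟨c⁻¹ • w.1, under_inv_smul_eq c w⟩,
        Pi.mulSingle_eq_of_ne (PlacesOver.galInv_ne c w hw), Units.val_one, map_one]
    rw [hμ, hlam, hlam, h1, h2, map_one, inv_one, mul_one]

omit [Algebra.IsQuadraticExtension F E] in
/-- **at EVERY split place a NON-QUADRATIC Step-2 character of the place model exists**: `μ = λ · (λ ∘ (c ⊗ 1))⁻¹` for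
`λ = ν_w ∘ pr_w`, `ν_w = ζ_3^{ord_w}` the unramified character of ORDER `3` (§2): unitary, continuous, trivial on `ι_v(F_vˣ)` (so it
satisfies the printed Step-2 clause, both sides of which are true at a split place), and `μ(z)² = ν_w(ϖ_w)² ≠ 1` at the unit `z`
with `w`-component a uniformiser and `w̄`-component `1` (`ν_w(ϖ_w)³ = 1 ≠ ν_w(ϖ_w)`).  This discharges the hypothesis `∃ x, μ(x)² ≠ 1`
of §8 at every split place. [cite: Liu2021, App. D §D.1 Step 2 (l. 5219)] -/
theorem exists_mu_sq_ne_one_of_split (w : PlacesOver E v) (hw : c • w.1 ≠ w.1) :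
    ∃ μ : (LocalRing E v)ˣ →* ℂˣ,
      (∀ x, ‖((μ x : ℂˣ) : ℂ)‖ = 1) ∧ (Continuous fun x => ((μ x : ℂˣ) : ℂ)) ∧
      (∀ a : (v.adicCompletion F)ˣ, μ (Units.map (algebraMap (v.adicCompletion F) (LocalRing E v)).toMonoidHom a) = 1) ∧
      ∃ x : (LocalRing E v)ˣ, μ x ^ 2 ≠ 1 := by
  classical
  obtain ⟨ν, hνnorm, hνcont, -, hν3, ϖ, -, hϖ⟩ := exists_unramified_character E w.1 (by norm_num : 2 ≤ 3)
  obtain ⟨μ, hμn, hμc, hμF, hμz⟩ := exists_mu_apply_single_of_split E v c w hw ν hνnorm hνcont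
  refine ⟨μ, hμn, hμc, hμF, MulEquiv.piUnits.symm (Pi.mulSingle w ϖ), ?_⟩
  rw [hμz]
  intro h2
  apply hϖ
  -- `ν ϖ ^ 3 = 1` and `ν ϖ ^ 2 = 1` force `ν ϖ = 1`
  have h3 := hν3 ϖ
  rw [pow_succ, h2, one_mul] at h3
  exact h3

/-- **… packaged with the printed clause in the `↔` form of the rows' binder `hμF`** (both sides true at a split place), ready for
§8 and for `LemD1OfPlace.muOf`. [cite: Liu2021, App. D §D.1 Step 2 (l. 5219)] -/
theorem exists_stepTwo_sq_ne_one_of_split (w : PlacesOver E v) (hw : c • w.1 ≠ w.1) :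
    ∃ (μ : (LocalRing E v)ˣ →* ℂˣ) (_hμn : ∀ x, ‖((μ x : ℂˣ) : ℂ)‖ = 1) (_hμc : Continuous fun x => ((μ x : ℂˣ) : ℂ))
      (_hμF : ∀ a : (v.adicCompletion F)ˣ,
        μ (Units.map (algebraMap (v.adicCompletion F) (LocalRing E v)).toMonoidHom a) = 1 ↔
          ∃ x : (LocalRing E v)ˣ, (x : LocalRing E v) * conjLocal E c v x =
            algebraMap (v.adicCompletion F) (LocalRing E v) a),
      ∃ x : (LocalRing E v)ˣ, μ x ^ 2 ≠ 1 := by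
  obtain ⟨μ, hμn, hμc, hμF, hx⟩ := exists_mu_sq_ne_one_of_split E v c w hw
  exact ⟨μ, hμn, hμc, fun a => iff_of_true (hμF a) (exists_mul_conjLocal_eq_algebraMap_of_split E v c w hw a), hx⟩

/-- **at EVERY split place, rank `N ≥ 3`, [Lem. D.1 (3)] AS PRINTED is VIOLATED by a two-`μ`-label collection satisfying (1)** —
§8's `exists_lemD1IndexedFamily_item1_not_lemD1_3_of_sq_ne_one` at the non-quadratic Step-2 character of
`exists_stepTwo_sq_ne_one_of_split`: labels `(μ, e, 1)`, `(μ³, e, 1)` with `μ ≠ μ³` through `LemD1OfPlace.muOf`, both carriers the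
trivial line.  Together with §6 (`exists_lemD1IndexedFamily_of_split`: a two-`μ`-label collection satisfying (1) AND (3)) this shows that
at the rows' slot types at a split place the record (3) is INDEPENDENT of «(1) for every member»: neither it nor its negation follows.
[cite: Liu2021, App. D Lemma D.1 (1) and (3) (l. 5229, 5233)] -/
theorem exists_lemD1IndexedFamily_item1_not_lemD1_3_of_split (w : PlacesOver E v) (hw : c • w.1 ≠ w.1) (h3 : 3 ≤ N)
    (e : LemD1.EpsRep (LemD1OfPlace.standingData E v c N J hcδ hδ hN hJh hJdet)) :
    ∃ Lf : LemD1IndexedFamily (v.adicCompletion F) (LocalRing E v) N (Fin 2),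
      Lf.S = LemD1OfPlace.standingData E v c N J hcδ hδ hN hJh hJdet ∧
      (∀ i, (Lf.eps i).1 = e.1) ∧ (∀ i, (Lf.chi i).1 = 1) ∧ (Lf.mu 1).1 = (Lf.mu 0).1 ^ 3 ∧
      Lf.Item1AsPrinted ∧ Lf.mu 0 ≠ Lf.mu 1 ∧ ¬ LemD1_3AsPrintedI Lf := by
  obtain ⟨μ, hμn, hμc, hμF, hμ2⟩ := exists_stepTwo_sq_ne_one_of_split E v c w hw
  obtain ⟨Lf, hS, heps, hchi, h0, h1, hI1, hne, hnot3⟩ :=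
    exists_lemD1IndexedFamily_item1_not_lemD1_3_of_sq_ne_one E v c N J hcδ hδ hN hJh hJdet h3 μ hμn hμc hμF hμ2 e
  exact ⟨Lf, hS, heps, hchi, by rw [h1, h0], hI1, hne, hnot3⟩

/-- **Consequence at a split place**: the displayed pair of records does NOT reduce to «(1) for every member» there — (3) is not a
consequence of (1) at the rows' slot types (rank `N ≥ 3`). [cite: Liu2021, App. D Lemma D.1 (1) and (3) (l. 5229, 5233)] -/
theorem not_forall_lemD1_3_of_item1_of_split (w : PlacesOver E v) (hw : c • w.1 ≠ w.1) (h3 : 3 ≤ N) :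
    ¬ ∀ Lf : LemD1IndexedFamily (v.adicCompletion F) (LocalRing E v) N (Fin 2),
        Lf.S = LemD1OfPlace.standingData E v c N J hcδ hδ hN hJh hJdet → Lf.Item1AsPrinted → LemD1_3AsPrintedI Lf := by
  intro h
  obtain ⟨Lf, hS, -, -, -, hI1, -, hnot3⟩ :=
    exists_lemD1IndexedFamily_item1_not_lemD1_3_of_split E v c N J hcδ hδ hN hJh hJdet w hw h3
      (LemD1OfPlace.epsDelta E v c N J hcδ hδ hN hJh hJdet)
  exact hnot3 (h Lf hS hI1)

end SplitNonQuadratic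

end Literature.NumberTheory.Automorphic.Liu2021.LemD1IndexedNonVacuityAtPlace

end
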